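import Literature.AlgebraicGeometry.Morphisms.IsoOverOpen
import Literature.AlgebraicGeometry.Resolution.StrictTransformPersistence
import Literature.AlgebraicGeometry.Resolution.Blowups
import HarnessLib

/-!
# The scheme-theoretic image after an admissible blowing up of a factor is the strict
# transform (Stacks 0F3Y)

Topic: `Literature/AlgebraicGeometry/Resolution`. The Stacks Project, Tag 0F3Y (More on Flatness,
Lemma 38.33.5): "Let `X → S` and `Y → S` be morphisms of schemes. Let `U ⊂ X` be an open
subscheme. Let `V → X ×_S Y` be a quasi-compact morphism whose composition with the first
projection maps into `U`. Let `Z ⊂ X ×_S Y` be the scheme theoretic image of `V → X ×_S Y`. Let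
`X' → X` be a `U`-admissible blowup. Then the scheme theoretic image of `V → X' ×_S Y` is the
strict transform of `Z` with respect to the blowing up." It is used in the two-piece induction of
the Stacks Project's proof of Nagata's compactification theorem (Tag 0F40: "If we replace `X₁`
by a `V₁`-admissible blowing up, then `X₁₂` is replaced by the strict transform") and in Tag 0F3X.

PROVED, for a blowing up `b : X' → X` in an ideal sheaf `𝓘` of finite type with
`V → X ×_S Y → X` landing in `X ∖ V(𝓘)` (the printed `U`-admissibility), in the following form:
with `Z = im(v)`, `p : Z → X ×_S Y → X`, the strict transform `Z' ⊆ Z ×_X X'` of `p` along `b`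
(Stacks 080D, `blowupStrictTransform p b 𝓘`) carries a closed immersion
`κ : Z' → X' ×_S Y` (`strictTransformToProduct`; the base change of `Z ↪ X ×_S Y`), the lift
`v' : V → X' ×_S Y` of `v` factors as `v' = s' ≫ κ` with `s' : V → Z'` scheme-theoretically
dominant (`V → Z` is, and over `X ∖ V(𝓘)` nothing changes), hence `ker v' = ker κ` and the
scheme-theoretic image of `v'` is `Z'`: `im(v') ≅ Z'` over `X' ×_S Y`
(`imageLiftIsoStrictTransform`, with its compatibilities). The printed proof argues the same
way ("it suffices to show that the scheme theoretic image `Z''` of `V → Z'` is `Z'` […] `Z'` does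
not have any nonzero sections supported on `E`"), schematic density of `V → Z'` being exactly
that statement.

* `isCompact_inter_centreCompl_of_fg`, `quasiCompact_ι_centreCompl_of_fg` — the complement of
  the support of an ideal sheaf of finite type is retrocompact;
* `productComparison`, `isPullback_productComparison` — `X' ×_S Y → X ×_S Y` and the cartesian
  square over `X' → X`;
* `pullbackToProduct`, `isClosedImmersion_pullbackToProduct` — `Z ×_X X' → X' ×_S Y`, the base
  change of `Z ↪ X ×_S Y`, a closed immersion; `strictTransformToProduct` — `κ : Z' → X' ×_S Y`;
* `liftToBlowup` — the lift `V → X'` of `V → X` through `b⁻¹(X ∖ V(𝓘)) ≅ X ∖ V(𝓘)`;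
  `liftToProduct` — `v' : V → X' ×_S Y`; `liftToStrictTransform` — `s' : V → Z'`,
  scheme-theoretically dominant (`isSchemeTheoreticallyDominant_liftToStrictTransform`), with
  `s' ≫ κ = v'`;
* `ker_liftToProduct`, `imageLiftIsoStrictTransform` — **Stacks 0F3Y**: `ker v' = ker κ`, and the
  isomorphism `im(v') ≅ Z'` over `X' ×_S Y` (hence over `X'`, `Y`, and `X ×_S Y`).

## References

* The Stacks Project, Tag 0F3Y (Lemma 38.33.5) and its proof; Tags 080D, 0F40. [StacksProject]
-/

noncomputable section

-- Mathlib's pull-back API is stated through `abbrev`s over `limit`; as in Mathlib's own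
-- algebraic-geometry files we let `simp`/unification see through them.
set_option backward.isDefEq.respectTransparency false

open CategoryTheory CategoryTheory.Limits AlgebraicGeometry TopologicalSpace
open Literature.AlgebraicGeometry.Morphisms

namespace Literature.AlgebraicGeometry.Resolution

universe u

/-! ## The complement of the support of an ideal sheaf of finite type is retrocompact -/

section Retrocompact

variable {X : Scheme.{u}} {I : X.IdealSheafData}

/-- On an affine open `W` with `𝓘(W) = (f₁, …, fₙ)`, `W ∖ V(𝓘) = D(f₁) ∪ … ∪ D(fₙ)`. [folklore] -/
theorem inter_centreCompl_eq_biUnion_basicOpen (W : X.affineOpens) (s : Finset Γ(X, W))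
    (hIW : I.ideal W = Ideal.span (s : Set Γ(X, W))) :
    (W : Set X) ∩ (centreCompl I : Set X) = ⋃ f ∈ s, (X.basicOpen f : Set X) := by
  ext y
  constructor
  · rintro ⟨hyW, hyO⟩
    by_contra hyf
    apply hyO
    have hmem : y ∈ X.zeroLocus (U := W) (I.ideal W) ∩ (W : Set X) := by
      refine ⟨?_, hyW⟩
      rw [hIW, Scheme.zeroLocus_span]
      exact (X.mem_zeroLocus_iff _ _).mpr fun g hg hyg =>
        hyf (Set.mem_iUnion₂.mpr ⟨g, Finset.mem_coe.mp hg, hyg⟩)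
    rw [← Scheme.IdealSheafData.coe_support_inter] at hmem
    exact hmem.1
  · intro hy
    obtain ⟨f, hf, hyf⟩ := Set.mem_iUnion₂.mp hy
    refine ⟨X.basicOpen_le f hyf, fun hyK => ?_⟩
    have hmem : y ∈ (I.support : Set X) ∩ W := ⟨hyK, X.basicOpen_le f hyf⟩
    rw [Scheme.IdealSheafData.coe_support_inter, hIW, Scheme.zeroLocus_span] at hmem
    exact ((X.mem_zeroLocus_iff _ _).mp hmem.1 f (Finset.mem_coe.mpr hf)) hyf

/-- **The complement of the support of an ideal sheaf of finite type is retrocompact**: its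
intersection with every affine open is quasi-compact. [cite: StacksProject, Tag 01PH] -/
theorem isCompact_inter_centreCompl_of_fg (hI : ∀ W : X.affineOpens, (I.ideal W).FG)
    (W : X.affineOpens) : IsCompact ((W : Set X) ∩ (centreCompl I : Set X)) := by
  classical
  obtain ⟨s, hs⟩ := hI W
  rw [inter_centreCompl_eq_biUnion_basicOpen W s hs.symm]
  exact s.isCompact_biUnion fun f _ => (W.2.basicOpen f).isCompact

/-- Hence `X ∖ V(𝓘) ↪ X` is quasi-compact for `𝓘` of finite type. [cite: StacksProject, Tag 01PH] -/
theorem quasiCompact_ι_centreCompl_of_fg (hI : ∀ W : X.affineOpens, (I.ideal W).FG) :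
    QuasiCompact (centreCompl I).ι := by
  refine quasiCompact_iff_forall_isAffineOpen.mpr fun U hU => ?_
  rw [(centreCompl I).ι.isOpenEmbedding.isInducing.isCompact_iff]
  have e : ((centreCompl I).ι.base) '' (((centreCompl I).ι ⁻¹ᵁ U : (centreCompl I : Scheme.{u}).Opens) :
      Set (centreCompl I : Scheme.{u})) = (U : Set X) ∩ (centreCompl I : Set X) := by
    rw [show (((centreCompl I).ι ⁻¹ᵁ U : (centreCompl I : Scheme.{u}).Opens) :
        Set (centreCompl I : Scheme.{u})) = (centreCompl I).ι.base ⁻¹' (U : Set X) from rfl,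
      Set.image_preimage_eq_inter_range, Scheme.Opens.range_ι]
  rw [e]
  exact isCompact_inter_centreCompl_of_fg hI ⟨U, hU⟩

end Retrocompact

/-! ## `X' ×_S Y → X ×_S Y` and the base change of a closed subscheme of `X ×_S Y` -/

section Product

variable {X Y S X' : Scheme.{u}} (f : X ⟶ S) (g : Y ⟶ S) (b : X' ⟶ X)

/-- The comparison `X' ×_S Y → X ×_S Y` over `b : X' → X`. [folklore] -/
def productComparison : pullback (b ≫ f) g ⟶ pullback f g :=
  pullback.map (b ≫ f) g f g b (𝟙 Y) (𝟙 S) (by rw [Category.comp_id]) (by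
    rw [Category.comp_id, Category.id_comp])

/-- `X' ×_S Y → X ×_S Y → X` is `X' ×_S Y → X' → X`. [folklore] -/
@[reassoc (attr := simp)]
theorem productComparison_fst : productComparison f g b ≫ pullback.fst f g = pullback.fst (b ≫ f) g ≫ b :=
  pullback.lift_fst _ _ _

/-- `X' ×_S Y → X ×_S Y → Y` is the second projection. [folklore] -/
@[reassoc (attr := simp)]
theorem productComparison_snd : productComparison f g b ≫ pullback.snd f g = pullback.snd (b ≫ f) g := by
  rw [productComparison, pullback.lift_snd, Category.comp_id]

/-- The square `X' ×_S Y → X'`, `X' ×_S Y → X ×_S Y → X`, `b` is cartesian. [folklore] -/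
theorem isPullback_productComparison :
    IsPullback (pullback.fst (b ≫ f) g) (productComparison f g b) b (pullback.fst f g) := by
  refine IsPullback.of_bot ?_ (productComparison_fst f g b).symm (IsPullback.of_hasPullback f g)
  rw [productComparison_snd]
  exact IsPullback.of_hasPullback (b ≫ f) g

variable {Z : Scheme.{u}} (ι : Z ⟶ pullback f g)

/-- For `ι : Z → X ×_S Y` with `p = ι ≫ pr₁ : Z → X`, the morphism `Z ×_X X' → X' ×_S Y`
(components `Z ×_X X' → X'` and `Z ×_X X' → Z → X ×_S Y → Y`). [folklore] -/
def pullbackToProduct : pullback (ι ≫ pullback.fst f g) b ⟶ pullback (b ≫ f) g :=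
  pullback.lift (pullback.snd _ b) (pullback.fst _ b ≫ ι ≫ pullback.snd f g) (by
    rw [Category.assoc, Category.assoc, ← pullback.condition (f := f) (g := g),
      ← Category.assoc ι, ← pullback.condition_assoc])

/-- `Z ×_X X' → X' ×_S Y → X'` is the second projection. [folklore] -/
@[reassoc (attr := simp)]
theorem pullbackToProduct_fst :
    pullbackToProduct f g b ι ≫ pullback.fst (b ≫ f) g = pullback.snd _ b :=
  pullback.lift_fst _ _ _

/-- `Z ×_X X' → X' ×_S Y → Y` is `Z ×_X X' → Z → X ×_S Y → Y`. [folklore] -/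
@[reassoc (attr := simp)]
theorem pullbackToProduct_snd :
    pullbackToProduct f g b ι ≫ pullback.snd (b ≫ f) g = pullback.fst _ b ≫ ι ≫ pullback.snd f g :=
  pullback.lift_snd _ _ _

/-- `Z ×_X X' → X' ×_S Y → X ×_S Y` is `Z ×_X X' → Z → X ×_S Y`. [folklore] -/
@[reassoc]
theorem pullbackToProduct_productComparison :
    pullbackToProduct f g b ι ≫ productComparison f g b = pullback.fst _ b ≫ ι := by
  apply pullback.hom_ext
  · rw [Category.assoc, productComparison_fst, pullbackToProduct_fst_assoc]
    exact pullback.condition.symm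
  · rw [Category.assoc, productComparison_snd, pullbackToProduct_snd, Category.assoc]

/-- `Z ×_X X' → X' ×_S Y` is the base change of `ι : Z → X ×_S Y` along `X' ×_S Y → X ×_S Y`.
[folklore] -/
theorem isPullback_pullbackToProduct :
    IsPullback (pullbackToProduct f g b ι) (pullback.fst _ b) (productComparison f g b) ι := by
  refine IsPullback.of_right ?_ (pullbackToProduct_productComparison f g b ι)
    (isPullback_productComparison f g b)
  rw [pullbackToProduct_fst]
  exact (IsPullback.of_hasPullback (ι ≫ pullback.fst f g) b).flip

/-- Hence `Z ×_X X' → X' ×_S Y` is a closed immersion when `ι` is. [folklore] -/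
instance isClosedImmersion_pullbackToProduct [IsClosedImmersion ι] :
    IsClosedImmersion (pullbackToProduct f g b ι) :=
  MorphismProperty.of_isPullback (isPullback_pullbackToProduct f g b ι).flip ‹_›

variable (I : X.IdealSheafData)

/-- The closed immersion `κ : Z' → X' ×_S Y` of the strict transform `Z'` of `Z → X` along `b`
(with respect to `V(𝓘)`). [cite: StacksProject, Tag 0F3Y] -/
def strictTransformToProduct : blowupStrictTransform (ι ≫ pullback.fst f g) b I ⟶ pullback (b ≫ f) g :=
  blowupStrictTransformι (ι ≫ pullback.fst f g) b I ≫ pullbackToProduct f g b ι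

/-- `κ : Z' → X' ×_S Y` is a closed immersion. [folklore] -/
instance isClosedImmersion_strictTransformToProduct [IsClosedImmersion ι] :
    IsClosedImmersion (strictTransformToProduct f g b ι I) := by
  unfold strictTransformToProduct
  infer_instance

/-- `κ` followed by the projection to `X'` is the strict transform `Z' → X'` of `Z → X`. [folklore] -/
@[reassoc]
theorem strictTransformToProduct_fst : strictTransformToProduct f g b ι I ≫ pullback.fst (b ≫ f) g =
    blowupStrictTransformMap (ι ≫ pullback.fst f g) b I := by
  rw [strictTransformToProduct, Category.assoc, pullbackToProduct_fst]
  rfl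

/-- `κ` followed by `X' ×_S Y → X ×_S Y` is `Z' → Z ×_X X' → Z → X ×_S Y`. [folklore] -/
@[reassoc]
theorem strictTransformToProduct_productComparison :
    strictTransformToProduct f g b ι I ≫ productComparison f g b =
      blowupStrictTransformι (ι ≫ pullback.fst f g) b I ≫ pullback.fst _ b ≫ ι := by
  rw [strictTransformToProduct, Category.assoc, pullbackToProduct_productComparison]

end Product

/-! ## Lifting `V → X ×_S Y` to `X' ×_S Y` and to the strict transform -/

section Lift

variable {X Y S X' V : Scheme.{u}} (f : X ⟶ S) (g : Y ⟶ S) (b : X' ⟶ X) (I : X.IdealSheafData)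
  (v : V ⟶ pullback f g) (hv : Set.range (v ≫ pullback.fst f g) ⊆ (centreCompl I : Set X))
  [IsIso (b ∣_ centreCompl I)]

/-- `V → X ∖ V(𝓘)`. [folklore] -/
def toCentreCompl : V ⟶ (centreCompl I : Scheme.{u}) :=
  IsOpenImmersion.lift (centreCompl I).ι (v ≫ pullback.fst f g) (by rwa [Scheme.Opens.range_ι])

/-- `V → X ∖ V(𝓘) ↪ X` is `V → X ×_S Y → X`. [folklore] -/
@[reassoc (attr := simp)]
theorem toCentreCompl_ι : toCentreCompl f g I v hv ≫ (centreCompl I).ι = v ≫ pullback.fst f g :=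
  IsOpenImmersion.lift_fac _ _ _

/-- **The lift `V → X'` of `V → X` through `b⁻¹(X ∖ V(𝓘)) ≅ X ∖ V(𝓘)`.** [cite: StacksProject, Tag 0F3Y] -/
def liftToBlowup : V ⟶ X' :=
  toCentreCompl f g I v hv ≫ inv (b ∣_ centreCompl I) ≫ (b ⁻¹ᵁ centreCompl I).ι

/-- The lift `V → X'` composed with `b` is `V → X`. [folklore] -/
@[reassoc (attr := simp)]
theorem liftToBlowup_comp : liftToBlowup f g b I v hv ≫ b = v ≫ pullback.fst f g := by
  rw [liftToBlowup, Category.assoc, Category.assoc, ← morphismRestrict_ι, IsIso.inv_hom_id_assoc,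
    toCentreCompl_ι]

/-- The lift `V → X'` lands in `b⁻¹(X ∖ V(𝓘))`. [folklore] -/
theorem range_liftToBlowup_subset :
    Set.range (liftToBlowup f g b I v hv) ⊆ ((b ⁻¹ᵁ centreCompl I : X'.Opens) : Set X') := by
  rintro _ ⟨x, rfl⟩
  show b (liftToBlowup f g b I v hv x) ∈ centreCompl I
  rw [← Scheme.Hom.comp_apply, liftToBlowup_comp]
  exact hv ⟨x, rfl⟩

/-- **The lift `v' : V → X' ×_S Y` of `v`.** [cite: StacksProject, Tag 0F3Y] -/
def liftToProduct : V ⟶ pullback (b ≫ f) g :=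
  pullback.lift (liftToBlowup f g b I v hv) (v ≫ pullback.snd f g) (by
    rw [liftToBlowup_comp_assoc, pullback.condition, Category.assoc])

/-- `v'` followed by the projection to `X'` is the lift `V → X'`. [folklore] -/
@[reassoc (attr := simp)]
theorem liftToProduct_fst : liftToProduct f g b I v hv ≫ pullback.fst (b ≫ f) g = liftToBlowup f g b I v hv :=
  pullback.lift_fst _ _ _

/-- `v'` followed by the projection to `Y` is `V → X ×_S Y → Y`. [folklore] -/
@[reassoc (attr := simp)]
theorem liftToProduct_snd : liftToProduct f g b I v hv ≫ pullback.snd (b ≫ f) g = v ≫ pullback.snd f g :=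
  pullback.lift_snd _ _ _

/-- `v'` lifts `v`: `v' ≫ (X' ×_S Y → X ×_S Y) = v`. [folklore] -/
@[reassoc (attr := simp)]
theorem liftToProduct_productComparison : liftToProduct f g b I v hv ≫ productComparison f g b = v := by
  apply pullback.hom_ext
  · rw [Category.assoc, productComparison_fst, liftToProduct_fst_assoc, liftToBlowup_comp]
  · rw [Category.assoc, productComparison_snd, liftToProduct_snd]

/-- `V → Z ×_X X'`, `Z = im(v)`: components `V → Z` and the lift `V → X'`. [folklore] -/
def liftToPullback : V ⟶ pullback (v.imageι ≫ pullback.fst f g) b :=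
  pullback.lift v.toImage (liftToBlowup f g b I v hv) (by
    rw [Scheme.Hom.toImage_imageι_assoc, liftToBlowup_comp])

/-- `V → Z ×_X X' → Z` is `V → Z`. [folklore] -/
@[reassoc (attr := simp)]
theorem liftToPullback_fst : liftToPullback f g b I v hv ≫ pullback.fst _ b = v.toImage :=
  pullback.lift_fst _ _ _

/-- `V → Z ×_X X' → X'` is the lift `V → X'`. [folklore] -/
@[reassoc (attr := simp)]
theorem liftToPullback_snd : liftToPullback f g b I v hv ≫ pullback.snd _ b = liftToBlowup f g b I v hv :=
  pullback.lift_snd _ _ _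

/-- `V → Z ×_X X'` lands in the open over `b⁻¹(X ∖ V(𝓘))`. [folklore] -/
theorem range_liftToPullback_subset :
    Set.range (liftToPullback f g b I v hv) ⊆ Set.range ((pullback.snd (v.imageι ≫ pullback.fst f g) b) ⁻¹ᵁ
      (b ⁻¹ᵁ centreCompl I)).ι := by
  rw [Scheme.Opens.range_ι]
  rintro _ ⟨x, rfl⟩
  show pullback.snd _ b (liftToPullback f g b I v hv x) ∈ b ⁻¹ᵁ centreCompl I
  rw [← Scheme.Hom.comp_apply, liftToPullback_snd]
  exact range_liftToBlowup_subset f g b I v hv ⟨x, rfl⟩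

/-- **`s' : V → Z'`, the lift of `V → Z ×_X X'` to the strict transform.** [cite: StacksProject, Tag 0F3Y] -/
def liftToStrictTransform : V ⟶ blowupStrictTransform (v.imageι ≫ pullback.fst f g) b I :=
  IsOpenImmersion.lift _ _ (range_liftToPullback_subset f g b I v hv) ≫
    ((pullback.snd (v.imageι ≫ pullback.fst f g) b) ⁻¹ᵁ (b ⁻¹ᵁ centreCompl I)).ι.toImage

/-- `s'` followed by `Z' ↪ Z ×_X X'` is `V → Z ×_X X'`. [folklore] -/
@[reassoc (attr := simp)]
theorem liftToStrictTransform_ι :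
    liftToStrictTransform f g b I v hv ≫ blowupStrictTransformι (v.imageι ≫ pullback.fst f g) b I =
      liftToPullback f g b I v hv := by
  rw [liftToStrictTransform, Category.assoc]
  change IsOpenImmersion.lift _ _ (range_liftToPullback_subset f g b I v hv) ≫
    (((pullback.snd (v.imageι ≫ pullback.fst f g) b) ⁻¹ᵁ (b ⁻¹ᵁ centreCompl I)).ι.toImage ≫
    ((pullback.snd (v.imageι ≫ pullback.fst f g) b) ⁻¹ᵁ (b ⁻¹ᵁ centreCompl I)).ι.imageι) = _
  rw [Scheme.Hom.toImage_imageι, IsOpenImmersion.lift_fac]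

/-- **`s' ≫ κ = v'`.** [cite: StacksProject, Tag 0F3Y] -/
@[reassoc]
theorem liftToStrictTransform_strictTransformToProduct :
    liftToStrictTransform f g b I v hv ≫ strictTransformToProduct f g b v.imageι I =
      liftToProduct f g b I v hv := by
  rw [strictTransformToProduct, liftToStrictTransform_ι_assoc]
  apply pullback.hom_ext
  · rw [Category.assoc, pullbackToProduct_fst, liftToPullback_snd, liftToProduct_fst]
  · rw [Category.assoc, pullbackToProduct_snd, liftToPullback_fst_assoc, liftToProduct_snd,
      Scheme.Hom.toImage_imageι_assoc]

/-- **`s' : V → Z'` is scheme-theoretically dominant** (for `X ∖ V(𝓘)` retrocompact, e.g. `𝓘`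
of finite type): `V → Z` is, hence so is `V → Z|_{X ∖ V(𝓘)}`; `Z ×_X X' → Z` is an isomorphism
over `Z|_{X ∖ V(𝓘)}`, whose preimage is the dense open of `Z'`. [cite: StacksProject, Tag 0F3Y] -/
theorem isSchemeTheoreticallyDominant_liftToStrictTransform [QuasiCompact v]
    [QuasiCompact (centreCompl I).ι] :
    IsSchemeTheoreticallyDominant (liftToStrictTransform f g b I v hv) := by
  set p := v.imageι ≫ pullback.fst f g with hp
  set O : (pullback p b).Opens := (pullback.snd p b) ⁻¹ᵁ (b ⁻¹ᵁ centreCompl I) with hO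
  set W : (v.image).Opens := p ⁻¹ᵁ centreCompl I with hW
  have hOW : O = (pullback.fst p b) ⁻¹ᵁ W := by
    rw [hO, hW, ← Scheme.Hom.comp_preimage, ← Scheme.Hom.comp_preimage, pullback.condition]
  -- `V → Z` factors through `W`, scheme-theoretically dominantly
  haveI := Motives.isSchemeTheoreticallyDominant_toImage v
  have hrange : Set.range v.toImage ⊆ Set.range W.ι := by
    rw [Scheme.Opens.range_ι]
    rintro _ ⟨x, rfl⟩
    show (v.toImage ≫ p) x ∈ centreCompl I
    rw [hp, Scheme.Hom.toImage_imageι_assoc]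
    exact hv ⟨x, rfl⟩
  set t₂ := IsOpenImmersion.lift W.ι v.toImage hrange with ht₂
  have ht₂ι : t₂ ≫ W.ι = v.toImage := IsOpenImmersion.lift_fac _ _ _
  haveI : QuasiCompact W.ι :=
    MorphismProperty.of_isPullback (isPullback_morphismRestrict p (centreCompl I)) inferInstance
  haveI : IsSchemeTheoreticallyDominant (t₂ ≫ W.ι) := by rw [ht₂ι]; infer_instance
  haveI : IsSchemeTheoreticallyDominant t₂ := IsSchemeTheoreticallyDominant.of_comp_isOpenImmersion t₂ W.ι
  -- `Z ×_X X' → Z` is an isomorphism over `W`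
  haveI : IsIso ((pullback.fst p b) ∣_ W) := isIso_morphismRestrict_pullback_fst p b (centreCompl I)
  -- the first factor `t₁ : V → O` of `s'` is `t₂` followed by the inverse of that isomorphism
  set t₁ := IsOpenImmersion.lift O.ι (liftToPullback f g b I v hv)
    (range_liftToPullback_subset f g b I v hv) with ht₁
  have ht₁ι : t₁ ≫ O.ι = liftToPullback f g b I v hv := IsOpenImmersion.lift_fac _ _ _
  set ρ : (O : Scheme.{u}) ⟶ W := ((pullback p b).isoOfEq hOW).hom ≫ ((pullback.fst p b) ∣_ W)
    with hρ
  haveI : IsIso ρ := by rw [hρ]; infer_instance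
  have hρι : ρ ≫ W.ι = O.ι ≫ pullback.fst p b := by
    rw [hρ, Category.assoc, morphismRestrict_ι, Scheme.isoOfEq_hom_ι_assoc]
  have ht₁ρ : t₁ ≫ ρ = t₂ := by
    rw [← cancel_mono W.ι, Category.assoc, hρι, ← Category.assoc, ht₁ι, liftToPullback_fst, ht₂ι]
  haveI : IsSchemeTheoreticallyDominant t₁ := by
    have h : t₁ = t₂ ≫ inv ρ := by rw [← ht₁ρ, Category.assoc, IsIso.hom_inv_id, Category.comp_id]
    rw [h]
    infer_instance
  haveI : QuasiCompact O.ι := by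
    rw [hOW]
    exact MorphismProperty.of_isPullback (isPullback_morphismRestrict (pullback.fst p b) W)
      inferInstance
  haveI := Motives.isSchemeTheoreticallyDominant_toImage O.ι
  change IsSchemeTheoreticallyDominant (t₁ ≫ O.ι.toImage)
  infer_instance

/-- **Stacks 0F3Y: `ker v' = ker κ`**, i.e. the scheme-theoretic image of `v' : V → X' ×_S Y` is
the strict transform `Z'`. [cite: StacksProject, Tag 0F3Y] -/
theorem ker_liftToProduct [QuasiCompact v] [QuasiCompact (centreCompl I).ι] :
    (liftToProduct f g b I v hv).ker = (strictTransformToProduct f g b v.imageι I).ker := by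
  haveI := isSchemeTheoreticallyDominant_liftToStrictTransform f g b I v hv
  rw [← liftToStrictTransform_strictTransformToProduct, Scheme.Hom.ker_comp,
    IsSchemeTheoreticallyDominant.ker_eq_bot, Scheme.IdealSheafData.map_bot]

/-- The comparison `im(v') → Z'` over `X' ×_S Y` (it exists because `v' = s' ≫ κ` factors
through the closed immersion `κ`). [cite: StacksProject, Tag 0F3Y] -/
def imageLiftToStrictTransform :
    (liftToProduct f g b I v hv).image ⟶ blowupStrictTransform (v.imageι ≫ pullback.fst f g) b I :=
  IsClosedImmersion.lift (strictTransformToProduct f g b v.imageι I) (liftToProduct f g b I v hv).imageι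
    (by
      rw [show (liftToProduct f g b I v hv).imageι.ker = (liftToProduct f g b I v hv).ker from
          Scheme.IdealSheafData.ker_subschemeι _,
        ← liftToStrictTransform_strictTransformToProduct]
      exact Scheme.Hom.le_ker_comp _ _)

/-- The comparison `im(v') → Z'` is a morphism over `X' ×_S Y`. [folklore] -/
@[reassoc (attr := simp)]
theorem imageLiftToStrictTransform_comp :
    imageLiftToStrictTransform f g b I v hv ≫ strictTransformToProduct f g b v.imageι I =
      (liftToProduct f g b I v hv).imageι :=
  IsClosedImmersion.lift_fac _ _ _

/-- `V → im(v') → Z'` is `s'`. [folklore] -/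
@[reassoc (attr := simp)]
theorem toImage_imageLiftToStrictTransform :
    (liftToProduct f g b I v hv).toImage ≫ imageLiftToStrictTransform f g b I v hv =
      liftToStrictTransform f g b I v hv := by
  rw [← cancel_mono (strictTransformToProduct f g b v.imageι I), Category.assoc,
    imageLiftToStrictTransform_comp, Scheme.Hom.toImage_imageι,
    liftToStrictTransform_strictTransformToProduct]

/-- **Stacks 0F3Y: the scheme-theoretic image of `v' : V → X' ×_S Y` is the strict transform
`Z'` of `Z = im(v)`**: the comparison `im(v') → Z'` is an isomorphism (for `X ∖ V(𝓘)`
retrocompact, e.g. `𝓘` of finite type). [cite: StacksProject, Tag 0F3Y] -/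
instance isIso_imageLiftToStrictTransform [QuasiCompact v] [QuasiCompact (centreCompl I).ι] :
    IsIso (imageLiftToStrictTransform f g b I v hv) :=
  IsClosedImmersion.isIso_lift _ _ ((ker_liftToProduct f g b I v hv).symm.trans
    (Scheme.IdealSheafData.ker_subschemeι _).symm)

/-- In particular the projection `im(v') → X'` is the comparison isomorphism followed by the
strict transform `Z' → X'` of `Z → X`. [cite: StacksProject, Tag 0F3Y] -/
theorem imageι_fst_eq :
    (liftToProduct f g b I v hv).imageι ≫ pullback.fst (b ≫ f) g =
      imageLiftToStrictTransform f g b I v hv ≫ blowupStrictTransformMap (v.imageι ≫ pullback.fst f g) b I := by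
  rw [← imageLiftToStrictTransform_comp, Category.assoc, strictTransformToProduct_fst]

end Lift

end Literature.AlgebraicGeometry.Resolution

end
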